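import Literature.Analysis.DeBrangesSpaces.ConreyLi2000SpacesFW
import Literature.Analysis.DeBrangesSpaces.PoissonLogModulus
import HarnessLib

/-!
# Conrey–Li 2000, Theorem 2: the kernels `K(w, ·)` lie in `𝓕(W)`, and the upper-half-plane half of the conclusion, PROVED

LABEL (line 1): RH-FREE; theorems about the GENERAL spaces `𝓕(W)` of
`Literature/Analysis/DeBrangesSpaces/ConreyLi2000SpacesFW.lean` (the positivity condition is a
HYPOTHESIS). bears_on: B-C/B-P (LADDER-RH §1, COLUMN 6 DBR). WHAT THIS IS NOT: not progress toward
RH — the hypothesis FAILS for `W = 1/ξ(1 − iz)` and every `W_χ` (Conrey–Li §3–§4; with this file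
those printed failures become unconditional tree theorems); nothing here bears on the truth of RH.

J. B. Conrey, X.-J. Li, IMRN 2000:18 = arXiv:math/9812166, §2, Theorem 2 and the first lines of its
proof (arXiv p. 2: "If `F(z) = Σ c_α K(w_α, z)`, then `TF(z) = Σ c_β K(w_β + i, z)`. By assumption
… `Σ c_α c̄_β [K(w_α, w_β+i) + K(w_α+i, w_β)] = 2 Re⟨F, TF⟩ ≥ 0` … This implies that
`Re{W(z)/W(z+i)} ≥ 0` for `z` in the upper half-plane.").

## What is proved

For `W` analytic and zero-free on the open upper half-plane and `Im w > 0`: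

* `SpaceF.kernel_mem`: the kernel function `K(w, ·)` is a member of `𝓕(W)` in the sense of
  `SpaceF.Mem` (Conrey–Li's definition as typed): `K(w, ·)/W = conj W(w)/(2πi(w̄ − ·))` is bounded
  and analytic on the upper half-plane (bounded type with denominator `1`), has the continuous
  boundary function `conj W(w)/(2πi(w̄ − x))`, which is in `L²(ℝ)`, and satisfies the Poisson
  log-majorant inequality WITH EQUALITY (`integral_log_norm_sub_div`: the Poisson integral of
  `log|t − w̄|` is `log|z − w̄|`). This is the non-vacuity of the typed hypothesis of Theorem 2.
* `SpaceF.inner_kernel_kernelShift`: for a kernel shift `T`,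
  `⟨K(w,·), T K(w,·)⟩_{𝓕(W)} = conj W(w) · W(w+i) / (2π(1 + 2 Im w))` — the `r = 1` case of the
  printed display, by the reproducing-type Cauchy integral `∫_ℝ dx/((x − w̄)(x − w − i)) =
  2π/(1 + 2 Im w)` (tree `integral_div_sub_eq_of_im_pos`).
* `conreyLi2000_thm2_upperHalfPlane`: under the hypotheses of Theorem 2,
  `Re{W(z)/W(z+i)} ≥ 0` for every `z` in the OPEN upper half-plane — the first printed conclusion,
  unconditionally; with `W` continuous on the closed upper half-plane also at real points
  (`conreyLi2000_thm2_closedUpperHalfPlane`, by a limit). The analytic extension of `W` to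
  `Im z > −1/2` (the contraction/adjoint part of the printed proof) is NOT proved here and remains
  in the named fact `conreyLi2000_thm2`.
* Consequently the contrapositive used in §3: if `Re{W(z₀)/W(z₀+i)} < 0` at some `z₀` with
  `Im z₀ ≥ 0` (`W` continuous on the closed half-plane), NO kernel shift `T` of `𝓕(W)` satisfies the
  positivity condition (3.3) (`SpaceF.not_positivity_of_re_div_neg`) — unconditional.

## References

* [ConreyLi2000] J. B. Conrey, X.-J. Li, IMRN 2000:18, 929–940 = arXiv:math/9812166, §2 Theorem 2
  and (2.6) (read).
* [Rudin1987] W. Rudin, *Real and Complex Analysis*, Thm 17.16 (Poisson integral of `log` of an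
  outer function; half-plane form in `PoissonLogModulus.lean`).
-/

noncomputable section

open scoped Real Topology ComplexConjugate
open _root_.Complex _root_.MeasureTheory _root_.Filter _root_.Set

namespace Literature.Analysis.DeBrangesSpaces

namespace SpaceF

/-! ### The Cauchy-type function `q_w(z) = conj W(w) / (2πi (w̄ − z))` = `K(w, z)/W(z)` -/

/-- `q_w(z) = conj W(w)/(2πi(w̄ − z))`, the quotient `K(w, z)/W(z)` written without `W(z)`
(proof-internal abbreviation, kept as a plain lambda in statements). [cite: ConreyLi2000, §2 (2.6)] -/
theorem kernel_div_eq (W : ℂ → ℂ) (w : ℂ) {z : ℂ} (hz : W z ≠ 0) :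
    kernel W w z / W z = conj (W w) / (2 * π * I * (conj w - z)) :=
  kernel_div W hz

variable {W : ℂ → ℂ} {w : ℂ}

/-- For `Im w > 0` and `Im z ≥ 0`: `2πi(w̄ − z) ≠ 0`. [folklore] -/
private theorem den_ne_zero (hw : 0 < w.im) {z : ℂ} (hz : 0 ≤ z.im) :
    2 * (π : ℂ) * I * (conj w - z) ≠ 0 := by
  have h1 : conj w - z ≠ 0 := by
    intro h
    have := congrArg Complex.im h
    simp only [sub_im, conj_im, zero_im] at this
    linarith
  exact mul_ne_zero (mul_ne_zero (mul_ne_zero two_ne_zero (ofReal_ne_zero.2 Real.pi_ne_zero))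
    I_ne_zero) h1

/-- `‖2πi(w̄ − z)‖ = 2π ‖z − w̄‖`. [folklore] -/
private theorem norm_den (w z : ℂ) :
    ‖2 * (π : ℂ) * I * (conj w - z)‖ = 2 * π * ‖z - conj w‖ := by
  rw [norm_mul, norm_mul, norm_mul, Complex.norm_I, mul_one, Complex.norm_real,
    Real.norm_eq_abs, abs_of_pos Real.pi_pos, Complex.norm_two, norm_sub_rev]

/-- `log‖q_w(z)‖ = log(‖W w‖/2π) − log‖z − w̄‖` (for `W w ≠ 0`, `z ≠ w̄`). [folklore] -/
private theorem log_norm_q (hWw : W w ≠ 0) {z : ℂ} (hz : z ≠ conj w) :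
    Real.log ‖conj (W w) / (2 * π * I * (conj w - z))‖
      = Real.log (‖W w‖ / (2 * π)) - Real.log ‖z - conj w‖ := by
  have hzn : ‖z - conj w‖ ≠ 0 := norm_ne_zero_iff.2 (sub_ne_zero.2 hz)
  rw [norm_div, Complex.norm_conj, norm_den, Real.log_div (norm_ne_zero_iff.2 hWw)
    (mul_ne_zero (by positivity) hzn), Real.log_mul (by positivity) hzn,
    Real.log_div (norm_ne_zero_iff.2 hWw) (by positivity)]
  ring

/-- The vertical limit of `q_w` at a real point is its value: `q_w` is continuous at `x`
(`w̄ ≠ x`). [folklore] -/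
private theorem tendsto_q (hw : 0 < w.im) (c : ℂ) (x : ℝ) :
    Tendsto (fun y : ℝ ↦ c / (2 * π * I * (conj w - ((x : ℂ) + y * I)))) (𝓝[>] (0 : ℝ))
      (𝓝 (c / (2 * π * I * (conj w - x)))) := by
  have hcont : ContinuousAt (fun z : ℂ ↦ c / (2 * π * I * (conj w - z))) (x : ℂ) := by
    refine ContinuousAt.div continuousAt_const (by fun_prop) ?_
    exact den_ne_zero hw (by simp)
  have hpath : Tendsto (fun y : ℝ ↦ (x : ℂ) + y * I) (𝓝[>] (0 : ℝ)) (𝓝 (x : ℂ)) := by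
    have hc : Continuous fun y : ℝ ↦ (x : ℂ) + y * I := by fun_prop
    have h1 : Tendsto (fun y : ℝ ↦ (x : ℂ) + y * I) (𝓝 (0 : ℝ)) (𝓝 (x : ℂ)) := by
      simpa using hc.tendsto 0
    exact h1.mono_left nhdsWithin_le_nhds
  exact hcont.tendsto.comp hpath

/-- **Boundary values of a function that equals `q_w` on the open upper half-plane**: if
`G(z)/W(z) = c/(2πi(w̄ − z))` for `Im z > 0`, then `bdryValue (G/W) = c/(2πi(w̄ − ·))` on `ℝ`
(pointwise, as vertical limits). [cite: ConreyLi2000, §2 (definition of 𝓕(W): boundary values)] -/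
theorem bdryValue_eq_of_eqOn_q (hw : 0 < w.im) {G : ℂ → ℂ} {c : ℂ}
    (hG : ∀ z : ℂ, 0 < z.im → G z / W z = c / (2 * π * I * (conj w - z))) (x : ℝ) :
    Tendsto (fun y : ℝ ↦ G ((x : ℂ) + y * I) / W ((x : ℂ) + y * I)) (𝓝[>] (0 : ℝ))
        (𝓝 (c / (2 * π * I * (conj w - x)))) ∧
      bdryValue (fun z ↦ G z / W z) x = c / (2 * π * I * (conj w - x)) := by
  have hev : (fun y : ℝ ↦ c / (2 * π * I * (conj w - ((x : ℂ) + y * I))))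
      =ᶠ[𝓝[>] (0 : ℝ)] fun y : ℝ ↦ G ((x : ℂ) + y * I) / W ((x : ℂ) + y * I) := by
    filter_upwards [self_mem_nhdsWithin] with y hy
    exact (hG _ (by simpa using hy)).symm
  have ht := (tendsto_q hw c x).congr' hev
  exact ⟨ht, bdryValue_eq_of_tendsto ht⟩

/-! ### `K(w, ·) ∈ 𝓕(W)` -/

/-- The kernel function is analytic on the open upper half-plane (for `W` analytic there and
`Im w > 0`). [cite: ConreyLi2000, §2 (2.6)] -/
theorem differentiableOn_kernel (hW : DifferentiableOn ℂ W {z : ℂ | 0 < z.im}) (hw : 0 < w.im) :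
    DifferentiableOn ℂ (kernel W w) {z : ℂ | 0 < z.im} := by
  intro z hz
  have hz' : 0 < z.im := hz
  unfold kernel
  refine ((hW z hz).mul (differentiableWithinAt_const _)).div ?_ (den_ne_zero hw hz'.le)
  fun_prop

/-- `‖q_w(z)‖ ≤ ‖W w‖/(2π Im w)` on the closed upper half-plane. [folklore] -/
private theorem norm_q_le (hw : 0 < w.im) (c : ℂ) {z : ℂ} (hz : 0 ≤ z.im) :
    ‖c / (2 * π * I * (conj w - z))‖ ≤ ‖c‖ / (2 * π * w.im) := by
  rw [norm_div, norm_den]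
  have him : w.im ≤ ‖z - conj w‖ := by
    have h := Complex.abs_im_le_norm (z - conj w)
    have h2 : (z - conj w).im = z.im + w.im := by simp
    rw [h2, abs_of_pos (by linarith)] at h
    linarith
  exact div_le_div_of_nonneg_left (norm_nonneg _) (by positivity) (by nlinarith [Real.pi_pos])

/-- **`K(w, ·) ∈ 𝓕(W)`**: for `W` analytic and zero-free on the open upper half-plane and
`Im w > 0`, the kernel function `K(w, ·)` satisfies Conrey–Li's membership conditions
(`SpaceF.Mem`): `K(w,·)/W = conj W(w)/(2πi(w̄ − ·))` is bounded-type (bounded analytic over `1`), its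
boundary function `conj W(w)/(2πi(w̄ − x))` exists everywhere and is square integrable, and the
Poisson log-majorant inequality holds (with equality: `integral_log_norm_sub_div`). This is the
non-vacuity of the hypothesis of Theorem 2 ("`K(w, z)` is … an element", cf. the proof of
Theorem 1). [cite: ConreyLi2000, §2 (2.6) and Theorem 2] -/
theorem kernel_mem (hW : DifferentiableOn ℂ W {z : ℂ | 0 < z.im}) (hW0 : ∀ z : ℂ, 0 < z.im → W z ≠ 0)
    (hw : 0 < w.im) : Mem W (kernel W w) := by
  have hWw : W w ≠ 0 := hW0 w hw
  set c : ℂ := conj (W w) with hc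
  -- `K/W = q` on the open upper half-plane and its boundary function
  have hq : ∀ z : ℂ, 0 < z.im → kernel W w z / W z = c / (2 * π * I * (conj w - z)) :=
    fun z hz ↦ kernel_div_eq W w (hW0 z hz)
  have hbv : ∀ x : ℝ, bdryValue (fun z ↦ kernel W w z / W z) x = c / (2 * π * I * (conj w - x)) :=
    fun x ↦ (bdryValue_eq_of_eqOn_q hw hq x).2
  have hbv_fun : bdryValue (fun z ↦ kernel W w z / W z) = fun x : ℝ ↦ c / (2 * π * I * (conj w - x)) :=
    funext hbv
  have hcw : (conj w).im < 0 := by rw [conj_im]; linarith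
  refine ⟨differentiableOn_kernel hW hw, ?_, ?_, ?_, ?_⟩
  · -- bounded type: `φ = q`, `ψ = 1`
    refine ⟨fun z ↦ c / (2 * π * I * (conj w - z)), fun _ ↦ 1, ?_, differentiableOn_const _,
      ⟨‖c‖ / (2 * π * w.im), fun z hz ↦ norm_q_le hw c hz.le⟩, ⟨1, fun z _ ↦ by simp⟩,
      fun z _ ↦ one_ne_zero, fun z hz ↦ by rw [div_one]; exact hq z hz⟩
    intro z hz
    have hz' : 0 < z.im := hz
    have hd : DifferentiableAt ℂ (fun z : ℂ ↦ c / (2 * π * I * (conj w - z))) z :=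
      (differentiableAt_const c).div (by fun_prop) (den_ne_zero hw hz'.le)
    exact hd.differentiableWithinAt
  · -- boundary values exist (everywhere)
    exact ae_of_all _ fun x ↦ by rw [hbv x]; exact (bdryValue_eq_of_eqOn_q hw hq x).1
  · -- `L²` boundary function
    rw [hbv_fun]
    have hcont : Continuous fun x : ℝ ↦ c / (2 * π * I * (conj w - x)) :=
      Continuous.div continuous_const (by fun_prop) fun x ↦ den_ne_zero hw (by simp)
    rw [memLp_two_iff_integrable_sq_norm hcont.aestronglyMeasurable]
    have hint := (integrable_inv_sub_sq_add_sq w.re hw.ne').const_mul ((‖c‖ / (2 * π)) ^ 2)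
    refine hint.congr (ae_of_all _ fun x ↦ ?_)
    simp only
    rw [norm_div, norm_den]
    simp only [div_pow, mul_pow]
    rw [norm_ofReal_sub_sq, conj_re, conj_im, neg_sq]
    have h0 : (x - w.re) ^ 2 + w.im ^ 2 ≠ 0 := by positivity
    field_simp
  · -- Poisson log-majorant (with equality)
    intro x y hy
    have hint_log := integrable_log_norm_sub_div hcw.ne x hy.ne'
    have hint_const := (integrable_inv_sub_sq_add_sq x hy.ne').const_mul (Real.log (‖W w‖ / (2 * π)))
    have hlog_bv : ∀ t : ℝ, Real.log ‖bdryValue (fun z ↦ kernel W w z / W z) t‖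
        = Real.log (‖W w‖ / (2 * π)) - Real.log ‖(t : ℂ) - conj w‖ := by
      intro t
      rw [hbv t, hc, log_norm_q hWw]
      intro h
      have := congrArg Complex.im h
      simp at this
      linarith
    have hfun : (fun t : ℝ ↦ Real.log ‖bdryValue (fun z ↦ kernel W w z / W z) t‖ / ((t - x) ^ 2 + y ^ 2))
        = fun t : ℝ ↦ Real.log (‖W w‖ / (2 * π)) * ((t - x) ^ 2 + y ^ 2)⁻¹
          - Real.log ‖(t : ℂ) - conj w‖ / ((t - x) ^ 2 + y ^ 2) := by
      funext t; rw [hlog_bv t, sub_div, div_eq_mul_inv]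
    rw [hfun]
    refine ⟨hint_const.sub hint_log, fun hne ↦ ?_⟩
    rw [integral_sub hint_const hint_log, integral_const_mul, integral_inv_sub_sq_add_sq x hy,
      integral_log_norm_sub_div hcw x hy]
    -- left-hand side: `log‖q(x+iy)‖`
    have hzpt : 0 < ((x : ℂ) + y * I).im := by simpa using hy
    show Real.log ‖kernel W w ((x : ℂ) + y * I) / W ((x : ℂ) + y * I)‖ ≤ _
    rw [hq _ hzpt, hc, log_norm_q hWw]
    · have hyne : y ≠ 0 := hy.ne'
      have hπ : (π : ℝ) ≠ 0 := Real.pi_ne_zero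
      apply le_of_eq
      field_simp
    · intro h
      have := congrArg Complex.im h
      simp at this
      linarith

/-! ### `⟨K(w,·), T K(w,·)⟩` by the Cauchy integral -/

/-- `1/(z − w̄)` satisfies the half-plane Cauchy hypotheses; `∫_ℝ dx/((x − w̄)(x − v)) = 2πi/(v − w̄)`
for `Im w > 0`, `Im v > 0`. [folklore] -/
private theorem integral_inv_mul_inv (hw : 0 < w.im) {v : ℂ} (hv : 0 < v.im) :
    ∫ x : ℝ, ((x : ℂ) - conj w)⁻¹ / ((x : ℂ) - v) = 2 * π * I * (v - conj w)⁻¹ := by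
  set m : ℝ := w.im with hm
  have hcw : ∀ z : ℂ, 0 ≤ z.im → z - conj w ≠ 0 := by
    intro z hz h
    have := congrArg Complex.im h
    simp only [sub_im, conj_im, zero_im] at this
    linarith
  have hd : ∀ z : ℂ, 0 ≤ z.im → DifferentiableAt ℂ (fun z : ℂ ↦ (z - conj w)⁻¹) z :=
    fun z hz ↦ (differentiableAt_id.sub_const _).inv (hcw z hz)
  have hi : Integrable fun x : ℝ ↦ ‖((x : ℂ) - conj w)⁻¹‖ ^ 2 :=
    integrable_norm_inv_ofReal_sub_sq (w := conj w) (by rw [conj_im]; linarith)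
  set K : ℝ := max 1 m⁻¹ with hK
  have hb : ∀ z : ℂ, 0 < z.im → (0 : ℝ) ≤ ‖z‖ → ‖(z - conj w)⁻¹‖ ≤ K / Real.sqrt z.im := by
    intro z hz _
    have hzw : m ≤ ‖z - conj w‖ := by
      have h := Complex.abs_im_le_norm (z - conj w)
      have h2 : (z - conj w).im = z.im + m := by simp [hm]
      rw [h2, abs_of_pos (by linarith)] at h
      linarith
    have hzw' : z.im ≤ ‖z - conj w‖ := by
      have h := Complex.abs_im_le_norm (z - conj w)
      have h2 : (z - conj w).im = z.im + m := by simp [hm]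
      rw [h2, abs_of_pos (by linarith)] at h
      linarith
    have hpos : 0 < ‖z - conj w‖ := hw.trans_le hzw
    have hsqrt : Real.sqrt z.im ≤ K * ‖z - conj w‖ := by
      rcases le_or_gt 1 z.im with h1 | h1
      · have hs : Real.sqrt z.im ≤ z.im := by
          rw [Real.sqrt_le_left (by linarith)]; nlinarith
        calc Real.sqrt z.im ≤ ‖z - conj w‖ := hs.trans hzw'
          _ ≤ K * ‖z - conj w‖ := le_mul_of_one_le_left (norm_nonneg _) (le_max_left _ _)
      · have hs : Real.sqrt z.im ≤ 1 := by rw [Real.sqrt_le_one]; exact h1.le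
        calc Real.sqrt z.im ≤ 1 := hs
          _ ≤ m⁻¹ * ‖z - conj w‖ := by rw [le_inv_mul_iff₀ hw]; simpa using hzw
          _ ≤ K * ‖z - conj w‖ := mul_le_mul_of_nonneg_right (le_max_right _ _) (norm_nonneg _)
    rw [norm_inv, inv_le_comm₀ hpos (by positivity), inv_div]
    rw [div_le_iff₀ (lt_of_lt_of_le zero_lt_one (le_max_left _ _))]
    linarith
  have hK0 : (0 : ℝ) ≤ K := le_trans zero_le_one (le_max_left _ _)
  have h := integral_div_sub_eq_of_im_pos (R₀ := 0) hK0 hd hi hb hv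
  simpa using h

/-- **The scalar product of a kernel with its shift**, the `r = 1` case of the display in the
proof of Theorem 2: for a kernel shift `T` of `𝓕(W)` and `Im w > 0`,
`⟨K(w,·), T K(w,·)⟩_{𝓕(W)} = conj W(w) · W(w+i) / (2π (1 + 2 Im w))`
(`= K(w, w+i)` in the printed notation). The boundary functions are `conj W(w)/(2πi(w̄ − x))` and
`conj W(w+i)/(2πi(w̄ − i − x))`, and `∫_ℝ dx/((x − w̄)(x − w − i)) = 2π/(1 + 2 Im w)` by Cauchy's
formula along `ℝ`. [cite: ConreyLi2000, Theorem 2 (proof, first display) and (2.6)] -/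
theorem inner_kernel_kernelShift (hW0 : ∀ z : ℂ, 0 < z.im → W z ≠ 0) {T : (ℂ → ℂ) → (ℂ → ℂ)}
    (hT : IsKernelShift W T) (hw : 0 < w.im) :
    inner W (kernel W w) (T (kernel W w)) = conj (W w) * W (w + I) / (2 * π * (1 + 2 * w.im)) := by
  have hwI : 0 < (w + I).im := by simp; linarith
  set c₁ : ℂ := conj (W w) with hc₁
  set c₂ : ℂ := conj (W (w + I)) with hc₂
  have hq₁ : ∀ z : ℂ, 0 < z.im → kernel W w z / W z = c₁ / (2 * π * I * (conj w - z)) :=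
    fun z hz ↦ kernel_div_eq W w (hW0 z hz)
  have hq₂ : ∀ z : ℂ, 0 < z.im → T (kernel W w) z / W z = c₂ / (2 * π * I * (conj (w + I) - z)) := by
    intro z hz
    rw [hT.map_kernel w hw hz]
    exact kernel_div_eq W (w + I) (hW0 z hz)
  have hbv₁ : bdryValue (fun z ↦ kernel W w z / W z) = fun x : ℝ ↦ c₁ / (2 * π * I * (conj w - x)) :=
    funext fun x ↦ (bdryValue_eq_of_eqOn_q hw hq₁ x).2
  have hbv₂ : bdryValue (fun z ↦ T (kernel W w) z / W z)
      = fun x : ℝ ↦ c₂ / (2 * π * I * (conj (w + I) - x)) :=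
    funext fun x ↦ (bdryValue_eq_of_eqOn_q hwI hq₂ x).2
  unfold inner
  rw [hbv₁, hbv₂]
  -- the integrand is `c₁ conj c₂ /(4π²) · (x − w̄)⁻¹/(x − (w + i))`
  have hden₁ : ∀ x : ℝ, 2 * (π : ℂ) * I * (conj w - x) ≠ 0 := fun x ↦ den_ne_zero hw (by simp)
  have hden₂ : ∀ x : ℝ, 2 * (π : ℂ) * I * (conj (w + I) - x) ≠ 0 := fun x ↦ den_ne_zero hwI (by simp)
  have hxw : ∀ x : ℝ, (x : ℂ) - conj w ≠ 0 := by
    intro x h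
    have := congrArg Complex.im h; simp at this; linarith
  have hxv : ∀ x : ℝ, (x : ℂ) - (w + I) ≠ 0 := by
    intro x h
    have := congrArg Complex.im h; simp at this; linarith
  have hπ : (π : ℂ) ≠ 0 := ofReal_ne_zero.2 Real.pi_ne_zero
  have hpt : ∀ x : ℝ, c₁ / (2 * π * I * (conj w - x)) * conj (c₂ / (2 * π * I * (conj (w + I) - x)))
      = c₁ * conj c₂ / (4 * π ^ 2) * (((x : ℂ) - conj w)⁻¹ / ((x : ℂ) - (w + I))) := by
    intro x
    have e1 : conj (c₂ / (2 * π * I * (conj (w + I) - x)))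
        = conj c₂ / (-(2 * π * I) * ((w + I) - x)) := by
      simp only [map_div₀, map_mul, map_sub, Complex.conj_conj, Complex.conj_ofReal, Complex.conj_I,
        map_ofNat]
      ring
    rw [e1]
    field_simp
    ring_nf
    rw [Complex.I_sq]
    ring
  simp_rw [hpt]
  rw [integral_const_mul, integral_inv_mul_inv hw hwI]
  have e2 : w + I - conj w = (1 + 2 * w.im : ℝ) * I := by
    rw [add_sub_right_comm, Complex.sub_conj]
    push_cast
    ring
  have e3 : 2 * (π : ℂ) * I * ((((1 + 2 * w.im : ℝ)) : ℂ) * I)⁻¹ = 2 * π / ((1 + 2 * w.im : ℝ) : ℂ) := by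
    rw [mul_inv, Complex.inv_I, div_eq_mul_inv]
    ring_nf
    rw [Complex.I_sq]
    ring
  rw [e2, e3, hc₁, hc₂, Complex.conj_conj]
  have hr : (1 + 2 * w.im : ℝ) ≠ 0 := by linarith
  have hr' : (1 : ℂ) + 2 * (w.im : ℂ) ≠ 0 := by exact_mod_cast hr
  push_cast
  field_simp
  ring

/-! ### Theorem 2 on the upper half-plane, unconditionally -/

/-- **Conrey–Li 2000, Theorem 2, first conclusion on the OPEN upper half-plane — PROVED.** Let `W`
be analytic and zero-free on `{Im z > 0}`, `T` a linear transformation of `𝓕(W)` into itself with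
`T K(w,·) = K(w+i,·)` (`SpaceF.IsKernelShift`), and suppose `Re⟨F, TF⟩_{𝓕(W)} ≥ 0` for every
`F ∈ 𝓕(W)` (Conrey–Li's (3.3)). Then `Re{W(z)/W(z+i)} ≥ 0` for every `z` with `Im z > 0`. Proof
(the printed first step with `r = 1`): take `F = K(z, ·)`, a member by `kernel_mem`; then
`⟨F, TF⟩ = conj W(z) W(z+i)/(2π(1 + 2 Im z))` (`inner_kernel_kernelShift`), whose real part is
`≥ 0` iff `Re{W(z+i)/W(z)} ≥ 0` iff `Re{W(z)/W(z+i)} ≥ 0`. The remaining printed conclusion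
(analytic extension to `Im z > −1/2`) is the named fact `conreyLi2000_thm2`.
[cite: ConreyLi2000, Theorem 2] -/
theorem _root_.Literature.Analysis.DeBrangesSpaces.conreyLi2000_thm2_upperHalfPlane {W : ℂ → ℂ}
    (hW : DifferentiableOn ℂ W {z : ℂ | 0 < z.im}) (hW0 : ∀ z : ℂ, 0 < z.im → W z ≠ 0)
    {T : (ℂ → ℂ) → (ℂ → ℂ)} (hT : IsKernelShift W T)
    (hpos : ∀ F : ℂ → ℂ, Mem W F → 0 ≤ (inner W F (T F)).re)
    {z : ℂ} (hz : 0 < z.im) : 0 ≤ (W z / W (z + I)).re := by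
  have h := hpos (kernel W z) (kernel_mem hW hW0 hz)
  rw [inner_kernel_kernelShift hW0 hT hz] at h
  have hzI : 0 < (z + I).im := by simp; linarith
  have hWz : W z ≠ 0 := hW0 z hz
  have hWzI : W (z + I) ≠ 0 := hW0 (z + I) hzI
  have hr : 0 < 2 * π * (1 + 2 * z.im) := by positivity
  -- `Re(conj W(z) W(z+i)) ≥ 0`
  have h1 : 0 ≤ (conj (W z) * W (z + I)).re := by
    have e : conj (W z) * W (z + I) / (2 * π * (1 + 2 * z.im) : ℂ)
        = (((2 * π * (1 + 2 * z.im))⁻¹ : ℝ) : ℂ) * (conj (W z) * W (z + I)) := by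
      push_cast; field_simp
    rw [e, Complex.re_ofReal_mul] at h
    exact nonneg_of_mul_nonneg_right (by rwa [mul_comm] at h) (inv_pos.2 hr) |> fun h' ↦ by
      nlinarith [h, inv_pos.2 hr, h']
  -- `Re(W(z)/W(z+i)) = Re(conj W(z) W(z+i)) · (‖W z‖² ‖W(z+i)‖²)⁻¹ · ‖W z‖²`-type rescaling
  have e2 : W z / W (z + I) = (((‖W (z + I)‖ ^ 2)⁻¹ : ℝ) : ℂ) * conj (conj (W z) * W (z + I)) := by
    rw [map_mul, Complex.conj_conj, div_eq_mul_inv, Complex.inv_def, Complex.normSq_eq_norm_sq]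
    push_cast
    ring
  rw [e2, Complex.re_ofReal_mul, Complex.conj_re]
  exact mul_nonneg (by positivity) h1

/-- **Theorem 2's necessary condition at real points, PROVED**: if moreover `W` is continuous on
the closed upper half-plane `{0 ≤ Im z}` (as `1/ξ(1 − iz)` is), then `Re{W(z)/W(z+i)} ≥ 0` for all
`z` with `Im z ≥ 0` — by the open-half-plane statement and a limit `z + iy → z`, `y → 0⁺`.
[cite: ConreyLi2000, Theorem 2 and §3.1] -/
theorem _root_.Literature.Analysis.DeBrangesSpaces.conreyLi2000_thm2_closedUpperHalfPlane {W : ℂ → ℂ}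
    (hW : DifferentiableOn ℂ W {z : ℂ | 0 < z.im}) (hW0 : ∀ z : ℂ, 0 < z.im → W z ≠ 0)
    (hWc : ContinuousOn W {z : ℂ | 0 ≤ z.im}) (hW0c : ∀ z : ℂ, 0 ≤ z.im → W z ≠ 0)
    {T : (ℂ → ℂ) → (ℂ → ℂ)} (hT : IsKernelShift W T)
    (hpos : ∀ F : ℂ → ℂ, Mem W F → 0 ≤ (inner W F (T F)).re)
    {z : ℂ} (hz : 0 ≤ z.im) : 0 ≤ (W z / W (z + I)).re := by
  rcases hz.lt_or_eq with hlt | heq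
  · exact conreyLi2000_thm2_upperHalfPlane hW hW0 hT hpos hlt
  -- `z` real: limit along `z + iy`, `y → 0⁺`
  have hzI : 0 ≤ (z + I).im := by simp; linarith
  have hpath : Tendsto (fun y : ℝ ↦ z + y * I) (𝓝[>] (0 : ℝ)) (𝓝[{u : ℂ | 0 ≤ u.im}] z) := by
    have hc : Continuous fun y : ℝ ↦ z + y * I := by fun_prop
    have h1 : Tendsto (fun y : ℝ ↦ z + y * I) (𝓝 (0 : ℝ)) (𝓝 z) := by simpa using hc.tendsto 0
    refine tendsto_nhdsWithin_iff.2 ⟨h1.mono_left nhdsWithin_le_nhds, ?_⟩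
    filter_upwards [self_mem_nhdsWithin] with y hy
    simp only [add_im, mul_im, ofReal_re, I_im, ofReal_im, I_re, mul_one, mul_zero, add_zero]
    linarith [le_of_lt (show (0:ℝ) < y from hy)]
  have hpathI : Tendsto (fun y : ℝ ↦ z + y * I + I) (𝓝[>] (0 : ℝ)) (𝓝[{u : ℂ | 0 ≤ u.im}] (z + I)) := by
    have hc : Continuous fun y : ℝ ↦ z + y * I + I := by fun_prop
    have h1 : Tendsto (fun y : ℝ ↦ z + y * I + I) (𝓝 (0 : ℝ)) (𝓝 (z + I)) := by
      simpa using hc.tendsto 0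
    refine tendsto_nhdsWithin_iff.2 ⟨h1.mono_left nhdsWithin_le_nhds, ?_⟩
    filter_upwards [self_mem_nhdsWithin] with y hy
    simp only [add_im, mul_im, ofReal_re, I_im, ofReal_im, I_re, mul_one, mul_zero, add_zero]
    linarith [le_of_lt (show (0:ℝ) < y from hy)]
  have hlim : Tendsto (fun y : ℝ ↦ (W (z + y * I) / W (z + y * I + I)).re) (𝓝[>] (0 : ℝ))
      (𝓝 ((W z / W (z + I)).re)) := by
    have h1 := (hWc z (by exact hz)).tendsto.comp hpath
    have h2 := (hWc (z + I) hzI).tendsto.comp hpathI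
    exact (Complex.continuous_re.tendsto _).comp (h1.div h2 (hW0c (z + I) hzI))
  refine ge_of_tendsto hlim ?_
  filter_upwards [self_mem_nhdsWithin] with y hy
  have hy' : 0 < (z + y * I).im := by
    simp only [add_im, mul_im, ofReal_re, I_im, ofReal_im, I_re, mul_one, mul_zero, add_zero]
    linarith [show (0:ℝ) < y from hy]
  have := conreyLi2000_thm2_upperHalfPlane hW hW0 hT hpos hy'
  simpa [add_assoc] using this

/-- **Contrapositive used by Conrey–Li in §3, PROVED**: if `W` is analytic and zero-free on the open
upper half-plane, continuous and zero-free on the closed one, and `Re{W(z₀)/W(z₀+i)} < 0` at some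
`z₀` with `Im z₀ ≥ 0`, then NO linear transformation `T` of `𝓕(W)` taking `K(w,·)` to `K(w+i,·)`
satisfies `Re⟨F, TF⟩_{𝓕(W)} ≥ 0` for all `F ∈ 𝓕(W)` — "the space `𝓕(W)` does not satisfy the
condition (3.3)". Unconditional form of `conreyLi2000_thm2.not_positivity_of_re_div_neg`.
[cite: ConreyLi2000, §3.1 (3.4) and §3.2] -/
theorem not_positivity_of_re_div_neg {W : ℂ → ℂ}
    (hW : DifferentiableOn ℂ W {z : ℂ | 0 < z.im}) (hW0 : ∀ z : ℂ, 0 < z.im → W z ≠ 0)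
    (hWc : ContinuousOn W {z : ℂ | 0 ≤ z.im}) (hW0c : ∀ z : ℂ, 0 ≤ z.im → W z ≠ 0)
    {z₀ : ℂ} (hz₀ : 0 ≤ z₀.im) (hneg : (W z₀ / W (z₀ + I)).re < 0)
    {T : (ℂ → ℂ) → (ℂ → ℂ)} (hT : IsKernelShift W T) :
    ¬ ∀ F : ℂ → ℂ, Mem W F → 0 ≤ (inner W F (T F)).re := fun hpos ↦
  absurd (conreyLi2000_thm2_closedUpperHalfPlane hW hW0 hWc hW0c hT hpos hz₀) (not_le.2 hneg)

/-- The open-half-plane variant of the contrapositive (no continuity at the boundary needed):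
`Re{W(z₀)/W(z₀+i)} < 0` at some `z₀` with `Im z₀ > 0` excludes the positivity condition (3.3).
This is the form in which Sarnak's argument (§4 Remark) refutes (3.3)/(3.8): the witness `s₀` has
`Re s₀ > 1`, i.e. `z₀ = i(s₀ − 1)` lies in the open upper half-plane.
[cite: ConreyLi2000, §4 Remark] -/
theorem not_positivity_of_re_div_neg_of_im_pos {W : ℂ → ℂ}
    (hW : DifferentiableOn ℂ W {z : ℂ | 0 < z.im}) (hW0 : ∀ z : ℂ, 0 < z.im → W z ≠ 0)
    {z₀ : ℂ} (hz₀ : 0 < z₀.im) (hneg : (W z₀ / W (z₀ + I)).re < 0)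
    {T : (ℂ → ℂ) → (ℂ → ℂ)} (hT : IsKernelShift W T) :
    ¬ ∀ F : ℂ → ℂ, Mem W F → 0 ≤ (inner W F (T F)).re := fun hpos ↦
  absurd (conreyLi2000_thm2_upperHalfPlane hW hW0 hT hpos hz₀) (not_le.2 hneg)

end SpaceF

end Literature.Analysis.DeBrangesSpaces

end
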